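import Summits.CriticalPhenomena.PercolationContinuityZ3.Theorems.PercNearOneGluingNoHeavyLowerTailAntitheticTopCommon
import HarnessLib

/-!
# `NoHeavyLowerTail` (stmt-CriticalPhenomena-4575) — antithetic cluster pairs: **THEOREM M-TRIANGLE — the mixed shifted sum
# (M)_shift(G; P, Q) is nonnegative on EVERY graph in which `s, P, Q` form a triangle**, and the TRIANGLE–EAR THEOREM: CONJECTURE Δ2 at
# the penultimate vertex of any ear of length ≥ 3 between two adjacent neighbours of the source, on an ARBITRARY graph (prim-hp-2 gen 69,
# HOME/MEMO-gen69.md §1(g))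

Support file (`--supports stmt-CriticalPhenomena-4575`, hull-port prover `prim-hp-2`, gen 69).  No definitions, no named facts, no sorries;
standard axioms.  Notation of …AntitheticTopEar (`X T`, `Y T` the red / blue clusters of `s`; (M)_shift(E; P, Q) = the shifted sum on
`{P ∈ X, Q ∉ Y}`; TOP = `{P ∈ X ∖ Y}`).

**LEMMA M-Q (reduction at a neighbour of the source)** (`TopTriangle.mixed_shift_nonneg_of_topL`).  `K₁` any pair set with `sQ ∈ K₁` and
`QP ∉ K₁`; `E = K₁ + QP`.  Split (M)_shift(E; P, Q) along the colour of `QP`: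
* `QP` red: `Q ∉ Y` forces `sQ` red, so `Q ∈ X` and `P ∈ X` — the part is the CYLINDER `{QP red} ∩ {Q ∉ Y_E}`, nonnegative on every graph
  (`TopCommon.cylinder_notY_sum_nonneg`: one red-dominated box, frozen along the blue cluster of `Q`);
* `QP` blue: `Q ∉ Y_E ⟺ P, Q ∉ Y_{K₁}` and then `(X_E, Y_E) = (X_{K₁}, Y_{K₁})`: the part is `½ ×` the sum on `{P ∈ X ∖ Y, Q ∉ Y}` of `K₁`
  ("TOP with the side condition `Q ∉ Y`", TOPL).
So (M)_shift(K₁ + QP; P, Q) ⟸ TOPL_shift(K₁; P; {Q}).  (LEMMA D2Q-T of …AntitheticTopEar is the case `N_{K₁}(Q) = {s}`.)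

**THEOREM M-TRIANGLE** (`TopTriangle.mixed_shift_nonneg_triangle`).  If `sP, sQ, PQ ∈ G` (`s, P, Q` distinct) then (M)_shift(G; P, Q) ≥ 0
for all monotone `F⁻ ≤ F⁺`, `G⁻ ≤ G⁺` — on EVERY finite graph `G`.  (With `sP ∈ K₁`, `P ∉ Y` forces `sP` red, so TOPL = `{P ∉ Y, Q ∉ Y}`,
nonnegative by block freezing `Box.notY_sum_nonneg` with `L = {P, Q}`.)  THEOREM M1 (…AntitheticConeMixedShift) needed the cone hypothesis
at `Q`; here `G` is arbitrary away from the triangle.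

**TRIANGLE–EAR THEOREM** (`TopTriangle.triangle_ear_vertex_sum_nonneg`).  `G` loop-free with a triangle `sPQ`; an ear
`P = u 0, u 1, …, u a = y, x, Q` of fresh vertices (`a ≥ 1`, i.e. length ≥ 3).  Then for all monotone `F, G`
  `0 ≤ Σ_{ω : ¬(x ∈ X ω ∧ x ∈ Y ω)} (F(X ω) − F(Y ω))·(G(X ω) − G(Y ω))`,  `E = (G ∪ arm) + xQ + xy`
— the vertex antithetic inequality at `R = {x}` / CONJECTURE Δ2 at the ear vertex next to `Q` (and, by symmetry, next to `P`), with NO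
hypothesis on `G`: the shifted handle principle with a `z`-arm of length 0 (`Pendant.handle_vertex_sum_nonneg_of_shift`) + THEOREM
M-TRIANGLE.  Supersedes THEOREM T-EAR′ (…AntitheticTopEarAdj: there `Q` had degree 2 in the core).
[cite: VandenbergHaggstromKahn2005, §1 p. 6 ("Harris' inequality"), §1 p. 3 (open cluster `C_s`)]
-/

noncomputable section

namespace Summit.CriticalPhenomena.PercolationContinuityZ3.Theorems

open Literature.Probability.Percolation
open scoped Classical

namespace Antithetic

namespace TopTriangle

variable {V : Type*} [Fintype V]

/-- **LEMMA M-Q.**  `sQ ∈ K₁`, `QP ∉ K₁`, `s ≠ Q`, `P ≠ Q`.  If TOPL_shift(K₁; P; {Q}) holds —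
`0 ≤ Σ_{T : P ∈ X T, P ∉ Y T, Q ∉ Y T} (F⁺(X T) − F⁻(Y T))(G⁺(X T) − G⁻(Y T))` over `K₁` for all monotone `F⁻ ≤ F⁺`, `G⁻ ≤ G⁺` — then
(M)_shift(K₁ + QP; P, Q) holds. [this work] -/
theorem mixed_shift_nonneg_of_topL (K₁ : Set (Sym2 V)) (s P Q : V) (hsQ : s ≠ Q) (hPQ : P ≠ Q)
    (hsQK : s(s, Q) ∈ K₁) (hQPK : s(Q, P) ∉ K₁)
    (htopL : ∀ Fp Fm Gp Gm : Set V → ℝ, Monotone Fp → Monotone Fm → (∀ S, Fm S ≤ Fp S) →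
      Monotone Gp → Monotone Gm → (∀ S, Gm S ≤ Gp S) →
      0 ≤ ∑ T ∈ Finset.univ.filter (fun T : Set (Sym2 V) =>
          P ∈ openCluster (T ∩ K₁) s ∧ P ∉ openCluster (Tᶜ ∩ K₁) s ∧ Q ∉ openCluster (Tᶜ ∩ K₁) s),
        (Fp (openCluster (T ∩ K₁) s) - Fm (openCluster (Tᶜ ∩ K₁) s)) * (Gp (openCluster (T ∩ K₁) s) - Gm (openCluster (Tᶜ ∩ K₁) s)))
    (Fp Fm Gp Gm : Set V → ℝ) (hFp : Monotone Fp) (hFm : Monotone Fm) (hF : ∀ S, Fm S ≤ Fp S)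
    (hGp : Monotone Gp) (hGm : Monotone Gm) (hG : ∀ S, Gm S ≤ Gp S) :
    0 ≤ ∑ T ∈ Finset.univ.filter (fun T : Set (Sym2 V) =>
        P ∈ openCluster (T ∩ insert s(Q, P) K₁) s ∧ Q ∉ openCluster (Tᶜ ∩ insert s(Q, P) K₁) s),
      (Fp (openCluster (T ∩ insert s(Q, P) K₁) s) - Fm (openCluster (Tᶜ ∩ insert s(Q, P) K₁) s)) *
        (Gp (openCluster (T ∩ insert s(Q, P) K₁) s) - Gm (openCluster (Tᶜ ∩ insert s(Q, P) K₁) s)) := by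
  set E : Set (Sym2 V) := insert s(Q, P) K₁ with hEdef
  have hK₁E : K₁ ⊆ E := Set.subset_insert _ _
  have hQPE : s(Q, P) ∈ E := Set.mem_insert _ _
  have hsQE : s(s, Q) ∈ E := hK₁E hsQK
  set A : Set (Sym2 V) := {s(Q, P)} with hAdef
  have hAK : ∀ e ∈ A, e ∉ K₁ := fun e he => by rw [Set.mem_singleton_iff.1 he]; exact hQPK
  let Φ : Set (Sym2 V) → ℝ := fun T =>
    (Fp (openCluster (T ∩ E) s) - Fm (openCluster (Tᶜ ∩ E) s)) * (Gp (openCluster (T ∩ E) s) - Gm (openCluster (Tᶜ ∩ E) s))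
  -- `Q ∉ Y_E T` forces `sQ` red, hence `Q ∈ X_E T`
  have hsQred : ∀ T : Set (Sym2 V), Q ∉ openCluster (Tᶜ ∩ E) s → s(s, Q) ∈ T := fun T hQ => by
    by_contra h
    exact hQ (TwoStage.Cone.mem_cluster_of_adj (mem_openCluster_self _ s) ((openGraph_adj _ s Q).2 ⟨⟨h, hsQE⟩, hsQ⟩))
  have hQX : ∀ T : Set (Sym2 V), Q ∉ openCluster (Tᶜ ∩ E) s → Q ∈ openCluster (T ∩ E) s := fun T hQ =>
    TwoStage.Cone.mem_cluster_of_adj (mem_openCluster_self _ s) ((openGraph_adj _ s Q).2 ⟨⟨hsQred T hQ, hsQE⟩, hsQ⟩)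
  -- blue cluster of `E` vs `K₁` when `QP` is blue and `P, Q ∉ Y_{K₁}`
  have hYeq : ∀ T : Set (Sym2 V), s(Q, P) ∉ T → P ∉ openCluster (Tᶜ ∩ K₁) s → Q ∉ openCluster (Tᶜ ∩ K₁) s →
      openCluster (Tᶜ ∩ E) s = openCluster (Tᶜ ∩ K₁) s := by
    intro T hQP hP hQ
    apply Set.Subset.antisymm
    · refine TwoStage.Fan.cluster_subset_of_closed (mem_openCluster_self _ s) ?_
      intro u w hu huw
      obtain ⟨⟨hT, he⟩, hne⟩ := (openGraph_adj _ u w).1 huw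
      rcases he with he | he
      · rcases Sym2.eq_iff.1 he with ⟨rfl, -⟩ | ⟨rfl, -⟩
        · exact absurd hu hQ
        · exact absurd hu hP
      · exact TwoStage.Cone.mem_cluster_of_adj hu ((openGraph_adj _ u w).2 ⟨⟨hT, he⟩, hne⟩)
    · exact Freeze.openCluster_mono (Set.inter_subset_inter_right Tᶜ hK₁E) s
  -- red cluster of `E` vs `K₁` when `QP` is blue
  have hXeq : ∀ T : Set (Sym2 V), s(Q, P) ∉ T → openCluster (T ∩ E) s = openCluster (T ∩ K₁) s := by
    intro T hQP
    apply Set.Subset.antisymm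
    · refine TwoStage.Fan.cluster_subset_of_closed (mem_openCluster_self _ s) ?_
      intro u w hu huw
      obtain ⟨⟨hT, he⟩, hne⟩ := (openGraph_adj _ u w).1 huw
      rcases he with he | he
      · exact absurd (he ▸ hT) hQP
      · exact TwoStage.Cone.mem_cluster_of_adj hu ((openGraph_adj _ u w).2 ⟨⟨hT, he⟩, hne⟩)
    · exact Freeze.openCluster_mono (Set.inter_subset_inter_right T hK₁E) s
  -- split along the colour of `QP`
  rw [← Finset.sum_filter_add_sum_filter_not _ (fun T : Set (Sym2 V) => s(Q, P) ∈ T), Finset.filter_filter, Finset.filter_filter]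
  refine add_nonneg ?_ ?_
  · -- `QP` red: the cylinder `{QP red} ∩ {Q ∉ Y_E}`
    have hK₁' : ∀ ⦃A' A'' B' B'' : Set V⦄, A' ⊆ A'' → B'' ⊆ B' → Fp A' - Fm B' ≤ Fp A'' - Fm B'' :=
      fun A' A'' B' B'' hA hB => sub_le_sub (hFp hA) (hFm hB)
    have hK₂' : ∀ ⦃A' A'' B' B'' : Set V⦄, A' ⊆ A'' → B'' ⊆ B' → Gp A' - Gm B' ≤ Gp A'' - Gm B'' :=
      fun A' A'' B' B'' hA hB => sub_le_sub (hGp hA) (hGm hB)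
    have hso₁ : ∀ A' B' : Set V, 0 ≤ (Fp A' - Fm B') + (Fp B' - Fm A') := fun A' B' => by linarith [hF A', hF B']
    have hso₂ : ∀ A' B' : Set V, 0 ≤ (Gp A' - Gm B') + (Gp B' - Gm A') := fun A' B' => by linarith [hG A', hG B']
    have hcyl := TopCommon.cylinder_notY_sum_nonneg E s A {Q} hK₁' hso₁ hK₂' hso₂
    have hFc : Finset.univ.filter (fun T : Set (Sym2 V) =>
          (P ∈ openCluster (T ∩ E) s ∧ Q ∉ openCluster (Tᶜ ∩ E) s) ∧ s(Q, P) ∈ T) =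
        Finset.univ.filter (fun T : Set (Sym2 V) => A ⊆ T ∧ ∀ Q₁ ∈ ({Q} : Set V), Q₁ ∉ openCluster (Tᶜ ∩ E) s) := by
      refine Finset.filter_congr (fun T _ => ⟨fun h => ?_, fun h => ?_⟩)
      · exact ⟨fun e he => by rw [Set.mem_singleton_iff.1 he]; exact h.2,
          fun Q₁ hQ₁ => by rw [Set.mem_singleton_iff.1 hQ₁]; exact h.1.2⟩
      · have h2 : s(Q, P) ∈ T := h.1 rfl
        have hQ : Q ∉ openCluster (Tᶜ ∩ E) s := h.2 Q rfl
        exact ⟨⟨TwoStage.Cone.mem_cluster_of_adj (hQX T hQ) ((openGraph_adj _ Q P).2 ⟨⟨h2, hQPE⟩, hPQ.symm⟩), hQ⟩, h2⟩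
    rw [hFc]
    exact hcyl
  · -- `QP` blue: TOPL of `K₁`
    let g : Set (Sym2 V) → ℝ := fun T =>
      if P ∈ openCluster (T ∩ K₁) s ∧ P ∉ openCluster (Tᶜ ∩ K₁) s ∧ Q ∉ openCluster (Tᶜ ∩ K₁) s then
        (Fp (openCluster (T ∩ K₁) s) - Fm (openCluster (Tᶜ ∩ K₁) s)) * (Gp (openCluster (T ∩ K₁) s) - Gm (openCluster (Tᶜ ∩ K₁) s))
      else 0
    rw [Finset.sum_filter]
    refine TopCommon.fubini_branch_nonneg A ∅ g _ ?_ ?_ ?_ ?_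
    · rw [← Finset.sum_filter]; exact htopL Fp Fm Gp Gm hFp hFm hF hGp hGm hG
    · intro T; simp only [g, TopEar.inter_diff_eq hAK, TopEar.compl_diff_inter_eq hAK]
    · intro T hTA
      have hQP : s(Q, P) ∉ T := fun h => by
        have : s(Q, P) ∈ T ∩ A := ⟨h, rfl⟩
        rw [hTA] at this; exact this
      show (if (P ∈ openCluster (T ∩ E) s ∧ Q ∉ openCluster (Tᶜ ∩ E) s) ∧ s(Q, P) ∉ T then Φ T else 0) = g T
      by_cases hev : P ∈ openCluster (T ∩ E) s ∧ Q ∉ openCluster (Tᶜ ∩ E) s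
      · obtain ⟨hPX, hQY⟩ := hev
        have hQYK : Q ∉ openCluster (Tᶜ ∩ K₁) s := fun h => hQY (Freeze.openCluster_mono (Set.inter_subset_inter_right Tᶜ hK₁E) s h)
        have hPY : P ∉ openCluster (Tᶜ ∩ E) s := fun hP =>
          hQY (TwoStage.Cone.mem_cluster_of_adj hP ((openGraph_adj _ P Q).2
            ⟨⟨by rw [Sym2.eq_swap]; exact hQP, by rw [Sym2.eq_swap]; exact hQPE⟩, hPQ⟩))
        have hPYK : P ∉ openCluster (Tᶜ ∩ K₁) s := fun h => hPY (Freeze.openCluster_mono (Set.inter_subset_inter_right Tᶜ hK₁E) s h)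
        have hPXK : P ∈ openCluster (T ∩ K₁) s := by rw [← hXeq T hQP]; exact hPX
        rw [if_pos ⟨⟨hPX, hQY⟩, hQP⟩]
        simp only [g, if_pos (show P ∈ openCluster (T ∩ K₁) s ∧ P ∉ openCluster (Tᶜ ∩ K₁) s ∧ Q ∉ openCluster (Tᶜ ∩ K₁) s from
          ⟨hPXK, hPYK, hQYK⟩), Φ, hXeq T hQP, hYeq T hQP hPYK hQYK]
      · rw [if_neg (fun h => hev h.1)]
        have hnot : ¬ (P ∈ openCluster (T ∩ K₁) s ∧ P ∉ openCluster (Tᶜ ∩ K₁) s ∧ Q ∉ openCluster (Tᶜ ∩ K₁) s) := by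
          rintro ⟨hPXK, hPYK, hQYK⟩
          refine hev ⟨?_, ?_⟩
          · rw [hXeq T hQP]; exact hPXK
          · rw [hYeq T hQP hPYK hQYK]; exact hQYK
        simp only [g, if_neg hnot]
    · intro T hTA
      show (if (P ∈ openCluster (T ∩ E) s ∧ Q ∉ openCluster (Tᶜ ∩ E) s) ∧ s(Q, P) ∉ T then Φ T else 0) = 0
      have hQP : s(Q, P) ∈ T := by
        by_contra h
        apply hTA
        ext e
        simp only [Set.mem_inter_iff, hAdef, Set.mem_singleton_iff, Set.mem_empty_iff_false, iff_false, not_and]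
        intro he hee; rw [hee] at he; exact h he
      rw [if_neg (fun h => h.2 hQP)]

/-- **THEOREM M-TRIANGLE ((M)_shift on every graph with a triangle at the source).**  `sP, sQ, PQ ∈ G`, `s, P, Q` pairwise distinct.
Then `0 ≤ Σ_{T : P ∈ X T, Q ∉ Y T} (F⁺(X T) − F⁻(Y T))(G⁺(X T) − G⁻(Y T))` for all monotone `F⁻ ≤ F⁺`, `G⁻ ≤ G⁺` — hypothesis
(M)_shift of the shifted handle principle, on every finite graph with a triangle `sPQ`. [this work] -/
theorem mixed_shift_nonneg_triangle (G : Set (Sym2 V)) (s P Q : V) (hsQ : s ≠ Q) (hPQ : P ≠ Q) (hsP : s ≠ P)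
    (hsPG : s(s, P) ∈ G) (hsQG : s(s, Q) ∈ G) (hPQG : s(Q, P) ∈ G)
    (Fp Fm Gp Gm : Set V → ℝ) (hFp : Monotone Fp) (hFm : Monotone Fm) (hF : ∀ S, Fm S ≤ Fp S)
    (hGp : Monotone Gp) (hGm : Monotone Gm) (hG : ∀ S, Gm S ≤ Gp S) :
    0 ≤ ∑ T ∈ Finset.univ.filter (fun T : Set (Sym2 V) => P ∈ openCluster (T ∩ G) s ∧ Q ∉ openCluster (Tᶜ ∩ G) s),
      (Fp (openCluster (T ∩ G) s) - Fm (openCluster (Tᶜ ∩ G) s)) * (Gp (openCluster (T ∩ G) s) - Gm (openCluster (Tᶜ ∩ G) s)) := by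
  obtain ⟨K₁, hGE, hQPK⟩ : ∃ K₁ : Set (Sym2 V), G = insert s(Q, P) K₁ ∧ s(Q, P) ∉ K₁ :=
    ⟨G \ {s(Q, P)}, by rw [Set.insert_sdiff_singleton, Set.insert_eq_of_mem hPQG], fun h => h.2 rfl⟩
  subst hGE
  have hne1 : s(s, Q) ≠ s(Q, P) := fun h => by
    rcases Sym2.eq_iff.1 h with ⟨h1, -⟩ | ⟨h1, -⟩
    · exact hsQ h1
    · exact hsP h1
  have hne2 : s(s, P) ≠ s(Q, P) := fun h => by
    rcases Sym2.eq_iff.1 h with ⟨h1, -⟩ | ⟨h1, -⟩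
    · exact hsQ h1
    · exact hsP h1
  have hsQK : s(s, Q) ∈ K₁ := by
    rcases hsQG with h | h
    · exact absurd h hne1
    · exact h
  have hsPK : s(s, P) ∈ K₁ := by
    rcases hsPG with h | h
    · exact absurd h hne2
    · exact h
  refine mixed_shift_nonneg_of_topL K₁ s P Q hsQ hPQ hsQK hQPK ?_ Fp Fm Gp Gm hFp hFm hF hGp hGm hG
  -- TOPL at a neighbour of `s` = `{P ∉ Y, Q ∉ Y}`: block freezing
  intro Fp' Fm' Gp' Gm' hFp' hFm' hF' hGp' hGm' hG'
  have hev : Finset.univ.filter (fun T : Set (Sym2 V) =>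
        P ∈ openCluster (T ∩ K₁) s ∧ P ∉ openCluster (Tᶜ ∩ K₁) s ∧ Q ∉ openCluster (Tᶜ ∩ K₁) s) =
      Finset.univ.filter (fun T : Set (Sym2 V) => ∀ Q₁ ∈ ({P, Q} : Set V), Q₁ ∉ openCluster (Tᶜ ∩ K₁) s) := by
    refine Finset.filter_congr fun T _ => ⟨fun h => ?_, fun h => ?_⟩
    · intro Q₁ hQ₁
      rcases hQ₁ with rfl | hQ₁
      · exact h.2.1
      · rw [Set.mem_singleton_iff.1 hQ₁]; exact h.2.2
    · have hPY : P ∉ openCluster (Tᶜ ∩ K₁) s := h P (Set.mem_insert _ _)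
      refine ⟨?_, hPY, h Q (Set.mem_insert_of_mem _ rfl)⟩
      by_cases hred : s(s, P) ∈ T
      · exact TwoStage.Cone.mem_cluster_of_adj (mem_openCluster_self _ s) ((openGraph_adj _ s P).2 ⟨⟨hred, hsPK⟩, hsP⟩)
      · exact absurd (TwoStage.Cone.mem_cluster_of_adj (mem_openCluster_self (Tᶜ ∩ K₁) s)
          ((openGraph_adj (Tᶜ ∩ K₁) s P).2 ⟨⟨hred, hsPK⟩, hsP⟩)) hPY
  rw [hev]
  have hK₁' : ∀ ⦃A' A'' B' B'' : Set V⦄, A' ⊆ A'' → B'' ⊆ B' → Fp' A' - Fm' B' ≤ Fp' A'' - Fm' B'' :=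
    fun A' A'' B' B'' hA hB => sub_le_sub (hFp' hA) (hFm' hB)
  have hK₂' : ∀ ⦃A' A'' B' B'' : Set V⦄, A' ⊆ A'' → B'' ⊆ B' → Gp' A' - Gm' B' ≤ Gp' A'' - Gm' B'' :=
    fun A' A'' B' B'' hA hB => sub_le_sub (hGp' hA) (hGm' hB)
  have hso₁ : ∀ A' B' : Set V, 0 ≤ (Fp' A' - Fm' B') + (Fp' B' - Fm' A') := fun A' B' => by linarith [hF' A', hF' B']
  have hso₂ : ∀ A' B' : Set V, 0 ≤ (Gp' A' - Gm' B') + (Gp' B' - Gm' A') := fun A' B' => by linarith [hG' A', hG' B']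
  have h := Box.notY_sum_nonneg (K₁ := fun A' B' => Fp' A' - Fm' B') (K₂ := fun A' B' => Gp' A' - Gm' B') K₁ s ({P, Q} : Set V)
    hK₁' hso₁ hK₂' hso₂
  convert h using 2
  congr 1

/-- **TRIANGLE–EAR THEOREM (every graph).**  `G` loop-free with `sP, sQ, PQ ∈ G` (`s, P, Q` distinct); an arm `P = u 0, u 1, …, u a = y`
of fresh vertices; `x` fresh joined to `y` and `Q` (`y ≠ Q`, `yQ ∉ G ∪ arm`, so `a ≥ 1`).  Then for all monotone `F, G`:
`0 ≤ Σ_{ω : ¬(x ∈ X_E ω ∧ x ∈ Y_E ω)} (F(X_E ω) − F(Y_E ω))·(G(X_E ω) − G(Y_E ω))`, `E = (G ∪ arm) + xQ + xy` (written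
`insert x(u a) (insert xQ (G ∪ arm))`) — CONJECTURE Δ2 at `x`, no hypothesis on `G`. [this work] -/
theorem triangle_ear_vertex_sum_nonneg {G : Set (Sym2 V)} {s P Q : V} {u : ℕ → V} {a : ℕ}
    (hnd : ∀ f ∈ G, ¬ f.IsDiag) (hsQ : s ≠ Q) (hPQ : P ≠ Q) (hsP : s ≠ P)
    (hsPG : s(s, P) ∈ G) (hsQG : s(s, Q) ∈ G) (hPQG : s(Q, P) ∈ G)
    (hu0 : u 0 = P) (hufresh : ∀ i, 0 < i → i ≤ a → ∀ f ∈ G, u i ∈ f → f.IsDiag)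
    (huinj : ∀ i j, i ≤ a → j ≤ a → u i = u j → i = j) (hsu : ∀ i, 0 < i → i ≤ a → s ≠ u i) (hQu : ∀ i, 0 < i → i ≤ a → Q ≠ u i)
    {x : V} (hx : ∀ f ∈ G ∪ Cyc.edgeSet a u, x ∈ f → f.IsDiag) (hxs : x ≠ s) (hxy : x ≠ u a)
    (hxQ : x ≠ Q) (hyQ : u a ≠ Q) (hg : s(u a, Q) ∉ G ∪ Cyc.edgeSet a u)
    {F G' : Set V → ℝ} (hF : Monotone F) (hG : Monotone G') :
    0 ≤ ∑ ω ∈ Finset.univ.filter (fun ω : Set (Sym2 V) =>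
        ¬ ((openGraph (ω ∩ insert s(x, u a) (insert s(x, Q) (G ∪ Cyc.edgeSet a u)))).Reachable s x ∧
          (openGraph (ωᶜ ∩ insert s(x, u a) (insert s(x, Q) (G ∪ Cyc.edgeSet a u)))).Reachable s x)),
      (F (openCluster (ω ∩ insert s(x, u a) (insert s(x, Q) (G ∪ Cyc.edgeSet a u))) s) -
          F (openCluster (ωᶜ ∩ insert s(x, u a) (insert s(x, Q) (G ∪ Cyc.edgeSet a u))) s)) *
        (G' (openCluster (ω ∩ insert s(x, u a) (insert s(x, Q) (G ∪ Cyc.edgeSet a u))) s) -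
          G' (openCluster (ωᶜ ∩ insert s(x, u a) (insert s(x, Q) (G ∪ Cyc.edgeSet a u))) s)) := by
  -- (M)_shift(G; P, Q) by THEOREM M-TRIANGLE
  have hmix : ∀ Fp Fm Gp Gm : Set V → ℝ, Monotone Fp → Monotone Fm → (∀ S, Fm S ≤ Fp S) →
      Monotone Gp → Monotone Gm → (∀ S, Gm S ≤ Gp S) →
      0 ≤ ∑ T ∈ Finset.univ.filter (fun T : Set (Sym2 V) =>
          P ∈ openCluster (T ∩ G) s ∧ Q ∉ openCluster (Tᶜ ∩ G) s),
        (Fp (openCluster (T ∩ G) s) - Fm (openCluster (Tᶜ ∩ G) s)) *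
          (Gp (openCluster (T ∩ G) s) - Gm (openCluster (Tᶜ ∩ G) s)) :=
    fun Fp Fm Gp Gm hFp hFm hF' hGp hGm hG'' =>
      mixed_shift_nonneg_triangle G s P Q hsQ hPQ hsP hsPG hsQG hPQG Fp Fm Gp Gm hFp hFm hF' hGp hGm hG''
  -- the `z`-arm of length `0`
  let w : ℕ → V := fun _ => Q
  have hw0 : w 0 = Q := rfl
  have hE : Cyc.edgeSet a u ∪ G = (Cyc.edgeSet a u ∪ G) ∪ Cyc.edgeSet 0 w := by
    rw [TwoStage.Cone.edgeSet_zero, Set.union_empty]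
  have hufresh' : ∀ i, 0 < i → i ≤ a → ∀ f ∈ G ∪ Cyc.edgeSet 0 w, u i ∈ f → f.IsDiag := by
    intro i hi hia f hf huf
    rw [TwoStage.Cone.edgeSet_zero, Set.union_empty] at hf
    exact hufresh i hi hia f hf huf
  have hx' : ∀ f ∈ Cyc.edgeSet a u ∪ G, x ∈ f → f.IsDiag := by rw [Set.union_comm]; exact hx
  have hg' : s(u a, Q) ∉ Cyc.edgeSet a u ∪ G := by rw [Set.union_comm]; exact hg
  have h := Pendant.handle_vertex_sum_nonneg_of_shift (E₀ := G) (s := s) (P := P) (Q := Q) (u := u) (w := w) (a := a) (b := 0)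
    hu0 hw0 hufresh' (fun i hi hib => absurd hib (by omega)) huinj (fun i j hi hj _ => by omega) hsu
    (fun i hi hib => absurd hib (by omega)) (fun i hi hib => absurd hib (by omega)) hQu
    (fun j hj => absurd hj (Nat.not_lt_zero j)) hmix hnd (x := x) (by rw [← hE]; exact hx') hxs hxy hxQ hyQ (by rw [← hE]; exact hg')
    hF hG
  rw [← hE, hw0] at h
  have hset : insert s(x, u a) (insert s(x, Q) (G ∪ Cyc.edgeSet a u)) = insert s(x, u a) (insert s(x, Q) (Cyc.edgeSet a u ∪ G)) := by
    rw [Set.union_comm]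
  rw [hset]
  convert h using 3

end TopTriangle

end Antithetic

end Summit.CriticalPhenomena.PercolationContinuityZ3.Theorems
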